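import Literature.NumberTheory.LFunctions.WeilBlockRowsR
import Literature.NumberTheory.LFunctions.WeilBlockRowsFast
import HarnessLib

/-!
# Fast `PmCheck` rows: the rank-one penalty part of the augmented block, one `axpy` fold per row

RH-free helper for the GroundBarta block certificates (`--supports` the parity ladder item).  The claim rows
`WeilCert.checkPmRowG P Pm p k` of a deflated two-prime certificate compare the materialized block `Pm` with
`P = P_r(ν) + Σ_r μ_r ĉ_r ĉ_rᵀ` entry by entry; the rank-one part `rankOneQ R k l` re-scans the penalty data `R` and both
vectors `ĉ_r` for EVERY entry (farm, C83X even row 40: ≈ 7 s per row, of which ≈ 5–6 s rank-one, ≈ 1.5 s `P_r`; 16 rows per file,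
18 files per cell).  Here row `k` of the rank-one part is computed ONCE as the padded `axpy` fold
`Σ_r (μ_r ĉ_r[k']) • ĉ_r`, `k' = 2k+p` (`rankOneRowF`, `getD_rankOneRowF`), and `checkPmRowGF` / `checkPmRowG_of_GF` give the
original claim row from the fast one (same proposition).  Expected: ≈ 2–3 s per row ⇒ one or two `PmCheck` files per parity. [folklore]
-/

set_option linter.dupNamespace false

namespace Summit.RiemannHypothesis.RiemannHypothesis.Theorems.PmFast

open Literature.NumberTheory.LFunctions Literature.Analysis.ValidatedNumerics.ExpPoly

/-- Row `k'` of the rank-one matrix `Σ_r μ_r ĉ_r ĉ_rᵀ` as ONE padded `axpy` fold: `Σ_r (μ_r · ĉ_r[k']) • ĉ_r` (full index; the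
parity mask enters through the scalar `μ_r · maskV r k'`). [folklore] -/
def rankOneRowF (R : List (ℚ × ℕ × List ℚ)) (k' : ℕ) : List ℚ :=
  axpyFold (R.map fun r ↦ r.1 * maskV r k') (R.map fun r ↦ r.2.2)

/-- **Entries of the fast rank-one row**: for `l' ≡ k' (mod 2)`, `(rankOneRowF R k')_{l'} = rankOneQ R k' l'`. [folklore] -/
theorem getD_rankOneRowF (k' l' : ℕ) (hpar : l' % 2 = k' % 2) :
    ∀ R : List (ℚ × ℕ × List ℚ), (rankOneRowF R k').getD l' 0 = rankOneQ R k' l'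
  | [] => by simp [rankOneRowF, axpyFold, rankOneQ]
  | r :: R => by
      have ih := getD_rankOneRowF k' l' hpar R
      simp only [rankOneRowF, List.map_cons, axpyFold, rankOneQ, List.sum_cons] at ih ⊢
      rw [getD_polyAdd, getD_polySmul, ih]
      congr 1
      unfold maskV
      by_cases hk : k' % 2 = r.2.1 % 2
      · rw [if_pos hk, if_pos (hpar.trans hk)]; simp only [getV]
      · rw [if_neg hk]; ring

/-- **The fast claim row**: `Pm_{k,l} = P_r(ν)_{2k+p,2l+p} + (rank-one row 2k+p)_{2l+p}` for all `l < nb`, the rank-one row being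
computed once. [folklore] -/
def checkPmRowGF (c : WeilCert) (nu : List ℚ) (R : List (ℚ × ℕ × List ℚ)) (Pm : List (List ℚ)) (p k : ℕ) : Bool :=
  let row := rankOneRowF R (2 * k + p)
  allBelow c.nb fun l ↦ decide (getM Pm k l = c.prQ nu (2 * k + p) (2 * l + p) + row.getD (2 * l + p) 0)

/-- **`checkPmRowG` from the fast row** (same proposition, cheaper kernel evaluation; drop-in for the certificate files):
`P` must be (propositionally) `P_r(ν) + rankOneQ R`. [folklore] -/
theorem checkPmRowG_of_GF (c : WeilCert) {nu : List ℚ} {R : List (ℚ × ℕ × List ℚ)} {Pm : List (List ℚ)} {p k : ℕ}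
    {P : ℕ → ℕ → ℚ} (hP : ∀ a b, P a b = c.prQ nu a b + rankOneQ R a b)
    (h : checkPmRowGF c nu R Pm p k = true) : c.checkPmRowG P Pm p k = true := by
  unfold WeilCert.checkPmRowG
  refine WeilCert2.allBelow_of_forall fun l hl ↦ ?_
  have hl' := of_allBelow h hl
  rw [decide_eq_true_eq] at hl' ⊢
  rw [hl', hP, getD_rankOneRowF _ _ (by omega)]

end Summit.RiemannHypothesis.RiemannHypothesis.Theorems.PmFast
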